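import Literature.Computability.AlgebraicComplexity.MaxEntropyGivenMarginals
import Literature.Analysis.SpecialFunctions.KernelLog
import Mathlib.Analysis.SpecialFunctions.Log.Base
import HarnessLib

/-!
# Kernel-certified bounds for Shannon entropies and maximum entropies given marginals
(the numerical layer of laser-method certificates)

Topic `Literature/Computability/AlgebraicComplexity`.  The bounds on `ω` produced by the laser
method and its refinements are the optimal values of explicit non-convex programs whose
constraints are built from Shannon entropies `H(α)` of finitely supported distributions, the
penalties `P_α = max_{α' ∈ D(α)} H(α') − H(α)` of the asymmetric method, and logarithms of integers
(Vassilevska Williams–Xu–Xu–Zhou 2024, §8: "we … verify that the parameters satisfy all the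
constraints"; the parameters themselves are published as floating-point data).  A formal proof of
such a bound needs these quantities CERTIFIED at rational parameters.  This file provides the
kernel-decidable certificates (everything PROVED; the only `def`s are the checkers and the linear
forms they evaluate), on top of the tree's kernel logarithm `logIv` (`KernelLog.lean`, `log n` to
width `≈ 4·10⁻¹³` in `≈ 1.5 ms` of kernel time):

* `EntropyCert.logFormNonneg s` for a multiset `s` of pairs `(c, n) ∈ ℤ × ℕ` — a certificate that
  the **linear form in logarithms** `∑ c · log n` is `≥ 0` (`logFormVal_nonneg`; also `logFormPos`):
  interval evaluation with `logIv`, lower end-point `≥ 0`;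
* `EntropyCert.entropyGeCheck w W a b` / `entropyLeCheck` for natural weights `w : ι → ℕ` of total
  `W` — certificates for **`H(w/W) ≥ a/b`**, resp. **`H(w/W) ≤ a/b`** (bits, the tree's
  `shannonEntropy`), via `W log 2 · H(w/W) = W log W − ∑ wᵢ log wᵢ`
  (`log_two_mul_shannonEntropy_natWeights`) — sound by `shannonEntropy_ge_of_check` /
  `shannonEntropy_le_of_check`;
* `EntropyCert.maxEntLeCheck Φ w W uX uY uZ a b` — a certificate for
  **`max_{α' ∈ D_Φ(w/W)} H(α') ≤ a/b`** (`maxEntropyGivenMarginals`), hence for the penalty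
  `P_α ≤ a/b − H(α)`, by weak duality (`maxEntropyGivenMarginals_le_entropyDual`,
  `MaxEntropyGivenMarginals.lean`) at the multipliers `λ = log u` for positive RATIONAL `u_X, u_Y, u_Z`,
  where the dual value `log₂ (∑_Φ u_X u_Y u_Z) − ∑ α_X log₂ u_X − ∑ α_Y log₂ u_Y − ∑ α_Z log₂ u_Z` is
  again a linear form in logarithms of naturals — sound by `maxEntropyGivenMarginals_le_of_check`
  (tight up to the rational approximation of `e^{λ*}`, a second-order loss).

* `EntropyCert.maxEntGeCheck Φ w W p W' a b` — the converse direction **`max_D H ≥ a/b`** by a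
  WITNESS `p/W'` supported in `Φ` with the marginals of `w/W` and certified entropy
  (`maxEntropyGivenMarginals_ge_of_check`, `maxEntropyPenalty_ge_of_check`); and the adapters that
  feed rational data `w/W` to real-parameter statements: `natWeights_mem_stdSimplex`,
  `natWeights_support`, `marginalDist₁/₂/₃_natWeights` (the marginals of `w/W` are `W_X/W, W_Y/W, W_Z/W`
  with the natural marginal weights `margX/Y/Z`), `sum_margX/Y/Z`.

All certificates are closed by `decide +kernel` (see the tests at the end: `H(½,¼,¼) ≥ 3/2 − 10⁻⁹`,
`≤ 3/2 + 10⁻⁹`; `max_D H ≤ 3 + 10⁻⁹` for the uniform distribution on `2 × 2 × 2`, and the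
Coppersmith–Winograd support `{i + j + k = 2}`).  Rational parameters with a common denominator are
the intended input (`α = w/W`); real statements follow by continuity where needed, outside this file.

## References

* V. Vassilevska Williams, Y. Xu, Z. Xu, R. Zhou, *New bounds for matrix multiplication: from alpha
  to omega*, SODA 2024, arXiv:2307.07970, §5 (definition of `P_α`) and §8 (numerical verification of
  the constraints). [VassilevskaWilliamsXuXuZhou2024]
* F. Le Gall, *Powers of tensors and fast matrix multiplication*, ISSAC 2014, arXiv:1401.7714, §6
  (numerical solutions and their verification). [LeGall2014]
-/

open scoped BigOperators
open Finset

namespace Literature.Computability.AlgebraicComplexity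

namespace EntropyCert

open Literature.Analysis.SpecialFunctions.KernelLog (logIv logIv_sound)

/-! ## Linear forms in logarithms of natural numbers -/

section LogForms

/-- The scaled (by `2⁸⁰`) certified lower bound of `c · log n` read off the kernel enclosure
`logIv n = some (lo, hi)`: `c · lo` if `c ≥ 0`, else `c · hi` (`0` if there is no enclosure,
flagged by `logTermBad`). [folklore] -/
def logTermLower (c : ℤ) (n : ℕ) : ℤ :=
  match logIv n with
  | some b => if 0 ≤ c then c * b.1 else c * b.2
  | none => 0

/-- `1` if `log n` has no kernel enclosure (`n = 0` or `n ≥ 2²⁵⁶`), else `0`. [folklore] -/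
def logTermBad (n : ℕ) : ℕ :=
  match logIv n with
  | some _ => 0
  | none => 1

/-- The scaled certified lower bound of the linear form `∑_{(c,n) ∈ s} c · log n`. [folklore] -/
def logFormLower (s : Multiset (ℤ × ℕ)) : ℤ :=
  (s.map fun cn => logTermLower cn.1 cn.2).sum

/-- Number of terms of the form without an enclosure (must be `0`). [folklore] -/
def logFormBad (s : Multiset (ℤ × ℕ)) : ℕ :=
  (s.map fun cn => logTermBad cn.2).sum

/-- **Certificate for `∑ c · log n ≥ 0`.** [folklore] -/
def logFormNonneg (s : Multiset (ℤ × ℕ)) : Bool :=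
  decide (logFormBad s = 0) && decide (0 ≤ logFormLower s)

/-- **Certificate for `∑ c · log n > 0`.** [folklore] -/
def logFormPos (s : Multiset (ℤ × ℕ)) : Bool :=
  decide (logFormBad s = 0) && decide (0 < logFormLower s)

/-- The real value `∑_{(c,n) ∈ s} c · log n` of a linear form in logarithms. [folklore] -/
noncomputable def logFormVal (s : Multiset (ℤ × ℕ)) : ℝ :=
  (s.map fun cn => (cn.1 : ℝ) * Real.log cn.2).sum

/-- `logFormVal` of a cons. [folklore] -/
theorem logFormVal_cons (a : ℤ × ℕ) (s : Multiset (ℤ × ℕ)) :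
    logFormVal (a ::ₘ s) = (a.1 : ℝ) * Real.log a.2 + logFormVal s := by
  simp [logFormVal]

/-- `logFormVal 0 = 0`. [folklore] -/
theorem logFormVal_zero : logFormVal 0 = 0 := by simp [logFormVal]

/-- `logFormVal` is additive. [folklore] -/
theorem logFormVal_add (s t : Multiset (ℤ × ℕ)) :
    logFormVal (s + t) = logFormVal s + logFormVal t := by
  simp [logFormVal]

/-- Soundness of one term: `logTermLower c n ≤ 2⁸⁰ · c · log n`. [folklore] -/
theorem logTermLower_le {c : ℤ} {n : ℕ} (h : logTermBad n = 0) :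
    (logTermLower c n : ℝ) ≤ 2 ^ 80 * ((c : ℝ) * Real.log n) := by
  unfold logTermBad at h
  unfold logTermLower
  cases hl : logIv n with
  | none => simp [hl] at h
  | some b =>
    obtain ⟨lo, hi⟩ := b
    have hs := logIv_sound hl
    have h80 : (0 : ℝ) < 2 ^ 80 := by positivity
    have hlo : (lo : ℝ) ≤ 2 ^ 80 * Real.log n := by
      have := hs.1; rw [div_le_iff₀ h80] at this; linarith
    have hhi : 2 ^ 80 * Real.log n ≤ (hi : ℝ) := by
      have := hs.2; rw [le_div_iff₀ h80] at this; linarith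
    simp only
    split_ifs with hc
    · have hc' : (0 : ℝ) ≤ c := by exact_mod_cast hc
      push_cast
      nlinarith
    · have hc' : (c : ℝ) ≤ 0 := by exact_mod_cast (le_of_lt (not_le.mp hc))
      push_cast
      nlinarith

/-- Soundness of the form bound: `logFormLower s ≤ 2⁸⁰ · logFormVal s`. [folklore] -/
theorem logFormLower_le {s : Multiset (ℤ × ℕ)} (h : logFormBad s = 0) :
    (logFormLower s : ℝ) ≤ 2 ^ 80 * logFormVal s := by
  induction s using Multiset.induction_on with
  | empty => simp [logFormLower, logFormVal]
  | cons a s ih =>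
    simp only [logFormBad, Multiset.map_cons, Multiset.sum_cons] at h
    have ha : logTermBad a.2 = 0 := by omega
    have hs : logFormBad s = 0 := by unfold logFormBad; omega
    have h1 := logTermLower_le (c := a.1) ha
    have h2 := ih hs
    simp only [logFormLower, Multiset.map_cons, Multiset.sum_cons, Int.cast_add, logFormVal_cons]
    unfold logFormLower at h2
    linarith

/-- **Soundness of `logFormNonneg`**: `∑ c · log n ≥ 0`. [folklore] -/
theorem logFormVal_nonneg {s : Multiset (ℤ × ℕ)} (h : logFormNonneg s = true) : 0 ≤ logFormVal s := by
  simp only [logFormNonneg, Bool.and_eq_true, decide_eq_true_eq] at h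
  have h1 := logFormLower_le h.1
  have h2 : (0 : ℝ) ≤ logFormLower s := by exact_mod_cast h.2
  by_contra hV
  have : (2 : ℝ) ^ 80 * logFormVal s < 0 := mul_neg_of_pos_of_neg (by positivity) (not_le.mp hV)
  linarith

/-- **Soundness of `logFormPos`**: `∑ c · log n > 0`. [folklore] -/
theorem logFormVal_pos {s : Multiset (ℤ × ℕ)} (h : logFormPos s = true) : 0 < logFormVal s := by
  simp only [logFormPos, Bool.and_eq_true, decide_eq_true_eq] at h
  have h1 := logFormLower_le h.1
  have h2 : (0 : ℝ) < logFormLower s := by exact_mod_cast h.2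
  by_contra hV
  have : (2 : ℝ) ^ 80 * logFormVal s ≤ 0 :=
    mul_nonpos_of_nonneg_of_nonpos (by positivity) (not_lt.mp hV)
  linarith

/-- The two entries `(c, num u), (−c, den u)` representing `c · log u` for a positive rational `u`.
[folklore] -/
def ratLogEntries (c : ℤ) (u : ℚ) : Multiset (ℤ × ℕ) :=
  (c, u.num.toNat) ::ₘ (-c, u.den) ::ₘ 0

/-- `logFormVal (ratLogEntries c u) = c · log u` for `u > 0`. [folklore] -/
theorem logFormVal_ratLogEntries (c : ℤ) {u : ℚ} (hu : 0 < u) :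
    logFormVal (ratLogEntries c u) = c * Real.log (u : ℝ) := by
  have hnum : 0 < u.num := Rat.num_pos.2 hu
  have hden : (0 : ℝ) < u.den := by exact_mod_cast u.den_pos
  have hnumR : (0 : ℝ) < u.num := by exact_mod_cast hnum
  have hcast : ((u.num.toNat : ℕ) : ℝ) = (u.num : ℝ) := by
    have : (u.num.toNat : ℤ) = u.num := Int.toNat_of_nonneg hnum.le
    exact_mod_cast this
  have hu' : (u : ℝ) = (u.num : ℝ) / (u.den : ℝ) := Rat.cast_def u
  simp only [ratLogEntries, logFormVal_cons, logFormVal_zero, add_zero, hcast, Int.cast_neg]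
  rw [hu', Real.log_div hnumR.ne' hden.ne']
  ring

/-- **Certificate for `log₂ (p/q) ≥ a/b`**: the form `b log p − b log q − a log 2 ≥ 0`. [folklore] -/
def logbGeCheck (p q : ℕ) (a : ℤ) (b : ℕ) : Bool :=
  decide (0 < p) && decide (0 < q) && decide (0 < b) &&
    logFormNonneg (((b : ℤ), p) ::ₘ (-(b : ℤ), q) ::ₘ (-a, 2) ::ₘ 0)

/-- **Certificate for `log₂ (p/q) ≤ a/b`**: the form `a log 2 − b log p + b log q ≥ 0`. [folklore] -/
def logbLeCheck (p q : ℕ) (a : ℤ) (b : ℕ) : Bool :=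
  decide (0 < p) && decide (0 < q) && decide (0 < b) &&
    logFormNonneg ((-(b : ℤ), p) ::ₘ ((b : ℤ), q) ::ₘ (a, 2) ::ₘ 0)

/-- **Soundness of `logbGeCheck`**: `a/b ≤ log₂ (p/q)`. [folklore] -/
theorem logb_ge_of_check {p q : ℕ} {a : ℤ} {b : ℕ} (h : logbGeCheck p q a b = true) :
    (a : ℝ) / b ≤ Real.logb 2 ((p : ℝ) / q) := by
  simp only [logbGeCheck, Bool.and_eq_true, decide_eq_true_eq] at h
  obtain ⟨⟨⟨hp, hq⟩, hb⟩, hform⟩ := h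
  have hV := logFormVal_nonneg hform
  simp only [logFormVal_cons, logFormVal_zero, Int.cast_neg, Int.cast_natCast] at hV
  have hpR : (0 : ℝ) < p := by exact_mod_cast hp
  have hqR : (0 : ℝ) < q := by exact_mod_cast hq
  have hbR : (0 : ℝ) < b := by exact_mod_cast hb
  have hl2 : 0 < Real.log 2 := Real.log_pos one_lt_two
  rw [Real.logb, Real.log_div hpR.ne' hqR.ne', div_le_div_iff₀ hbR hl2]
  push_cast at hV
  nlinarith

/-- **Soundness of `logbLeCheck`**: `log₂ (p/q) ≤ a/b`. [folklore] -/
theorem logb_le_of_check {p q : ℕ} {a : ℤ} {b : ℕ} (h : logbLeCheck p q a b = true) :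
    Real.logb 2 ((p : ℝ) / q) ≤ (a : ℝ) / b := by
  simp only [logbLeCheck, Bool.and_eq_true, decide_eq_true_eq] at h
  obtain ⟨⟨⟨hp, hq⟩, hb⟩, hform⟩ := h
  have hV := logFormVal_nonneg hform
  simp only [logFormVal_cons, logFormVal_zero, Int.cast_neg, Int.cast_natCast] at hV
  have hpR : (0 : ℝ) < p := by exact_mod_cast hp
  have hqR : (0 : ℝ) < q := by exact_mod_cast hq
  have hbR : (0 : ℝ) < b := by exact_mod_cast hb
  have hl2 : 0 < Real.log 2 := Real.log_pos one_lt_two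
  rw [Real.logb, Real.log_div hpR.ne' hqR.ne', div_le_div_iff₀ hl2 hbR]
  push_cast at hV
  nlinarith

end LogForms

/-! ## Entropies of distributions with natural weights -/

section Entropy

variable {ι : Type*} [Fintype ι]

/-- **`log 2 · H(w/W) = log W − (∑ wᵢ log wᵢ)/W`** for natural weights `w` of total `W > 0`
(`H` in bits, `0 log 0 = 0`). [folklore] -/
theorem log_two_mul_shannonEntropy_natWeights (w : ι → ℕ) {W : ℕ} (hW : ∑ i, w i = W)
    (hW0 : 0 < W) :
    Real.log 2 * shannonEntropy (fun i => (w i : ℝ) / W) =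
      Real.log W - (∑ i, (w i : ℝ) * Real.log (w i)) / W := by
  have hl2 : Real.log 2 ≠ 0 := (Real.log_pos one_lt_two).ne'
  have hWR : (0 : ℝ) < W := by exact_mod_cast hW0
  rw [shannonEntropy_def, mul_div_cancel₀ _ hl2]
  have key : ∀ i, Real.negMulLog ((w i : ℝ) / W) =
      (w i : ℝ) / W * Real.log W - (w i : ℝ) * Real.log (w i) / W := by
    intro i
    rcases Nat.eq_zero_or_pos (w i) with h0 | hpos
    · simp [h0, Real.negMulLog]
    · have hwi : (0 : ℝ) < w i := by exact_mod_cast hpos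
      rw [Real.negMulLog, Real.log_div hwi.ne' hWR.ne']
      ring
  have hsum : ∑ i, (w i : ℝ) = W := by exact_mod_cast hW
  calc ∑ i, Real.negMulLog ((w i : ℝ) / W)
      = ∑ i, ((w i : ℝ) / W * Real.log W - (w i : ℝ) * Real.log (w i) / W) :=
        Finset.sum_congr rfl fun i _ => key i
    _ = (∑ i, (w i : ℝ)) / W * Real.log W - (∑ i, (w i : ℝ) * Real.log (w i)) / W := by
        rw [Finset.sum_sub_distrib, Finset.sum_div, Finset.sum_div, Finset.sum_mul]
    _ = Real.log W - (∑ i, (w i : ℝ) * Real.log (w i)) / W := by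
        rw [hsum, div_self hWR.ne', one_mul]

/-- The entries `−c · wᵢ log wᵢ` (zero weights contribute the neutral entry `(0, 1)`). [folklore] -/
def weightEntries (w : ι → ℕ) (c : ℤ) : Multiset (ℤ × ℕ) :=
  Finset.univ.val.map fun i => if w i = 0 then ((0 : ℤ), 1) else (-(c * (w i : ℤ)), w i)

/-- `logFormVal (weightEntries w c) = −c · ∑ wᵢ log wᵢ`. [folklore] -/
theorem logFormVal_weightEntries (w : ι → ℕ) (c : ℤ) :
    logFormVal (weightEntries w c) = -(c * ∑ i, (w i : ℝ) * Real.log (w i)) := by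
  unfold logFormVal weightEntries
  rw [Multiset.map_map, ← Finset.sum_eq_multiset_sum, Finset.mul_sum, ← Finset.sum_neg_distrib]
  refine Finset.sum_congr rfl fun i _ => ?_
  simp only [Function.comp_apply]
  split_ifs with h0
  · simp [h0]
  · push_cast
    ring

/-- `logFormBad (weightEntries w c)` needs no hypothesis beyond the kernel check; here is the value
side only. The linear form `b W log W − b ∑ wᵢ log wᵢ − a W log 2` for `H(w/W) ≥ a/b`. [folklore] -/
def entropyGeForm (w : ι → ℕ) (W : ℕ) (a : ℤ) (b : ℕ) : Multiset (ℤ × ℕ) :=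
  ((b : ℤ) * W, W) ::ₘ (-(a * W), 2) ::ₘ weightEntries w b

/-- The linear form `a W log 2 − b W log W + b ∑ wᵢ log wᵢ` for `H(w/W) ≤ a/b`. [folklore] -/
def entropyLeForm (w : ι → ℕ) (W : ℕ) (a : ℤ) (b : ℕ) : Multiset (ℤ × ℕ) :=
  (-((b : ℤ) * W), W) ::ₘ (a * W, 2) ::ₘ weightEntries w (-(b : ℤ))

/-- **Certificate for `H(w/W) ≥ a/b`** (bits). [folklore] -/
def entropyGeCheck (w : ι → ℕ) (W : ℕ) (a : ℤ) (b : ℕ) : Bool :=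
  decide (∑ i, w i = W) && decide (0 < W) && decide (0 < b) && logFormNonneg (entropyGeForm w W a b)

/-- **Certificate for `H(w/W) ≤ a/b`** (bits). [folklore] -/
def entropyLeCheck (w : ι → ℕ) (W : ℕ) (a : ℤ) (b : ℕ) : Bool :=
  decide (∑ i, w i = W) && decide (0 < W) && decide (0 < b) && logFormNonneg (entropyLeForm w W a b)

/-- Value of the `≥`-form. [folklore] -/
theorem logFormVal_entropyGeForm (w : ι → ℕ) (W : ℕ) (a : ℤ) (b : ℕ) :
    logFormVal (entropyGeForm w W a b) =
      (b : ℝ) * W * Real.log W - a * W * Real.log 2 - b * ∑ i, (w i : ℝ) * Real.log (w i) := by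
  simp only [entropyGeForm, logFormVal_cons, logFormVal_weightEntries]
  push_cast
  ring

/-- Value of the `≤`-form. [folklore] -/
theorem logFormVal_entropyLeForm (w : ι → ℕ) (W : ℕ) (a : ℤ) (b : ℕ) :
    logFormVal (entropyLeForm w W a b) =
      (a : ℝ) * W * Real.log 2 - b * W * Real.log W + b * ∑ i, (w i : ℝ) * Real.log (w i) := by
  simp only [entropyLeForm, logFormVal_cons, logFormVal_weightEntries]
  push_cast
  ring

/-- **Soundness of `entropyGeCheck`**: `a/b ≤ H(w/W)`. [folklore] -/
theorem shannonEntropy_ge_of_check {w : ι → ℕ} {W : ℕ} {a : ℤ} {b : ℕ}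
    (h : entropyGeCheck w W a b = true) :
    (a : ℝ) / b ≤ shannonEntropy (fun i => (w i : ℝ) / W) := by
  simp only [entropyGeCheck, Bool.and_eq_true, decide_eq_true_eq] at h
  obtain ⟨⟨⟨hW, hW0⟩, hb⟩, hform⟩ := h
  have hV := logFormVal_nonneg hform
  rw [logFormVal_entropyGeForm] at hV
  have hid := log_two_mul_shannonEntropy_natWeights w hW hW0
  have hWR : (0 : ℝ) < W := by exact_mod_cast hW0
  have hbR : (0 : ℝ) < b := by exact_mod_cast hb
  have hl2 : 0 < Real.log 2 := Real.log_pos one_lt_two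
  set H := shannonEntropy (fun i => (w i : ℝ) / W)
  -- `W log 2 · H = W log W − ∑ w log w`
  have hid' : (W : ℝ) * Real.log 2 * H = W * Real.log W - ∑ i, (w i : ℝ) * Real.log (w i) := by
    rw [mul_assoc, hid, mul_sub, mul_div_cancel₀ _ hWR.ne']
  rw [div_le_iff₀ hbR]
  -- from `hV`: `a W log 2 ≤ b (W log W − ∑)` = `b W log 2 H`
  have h1 : (a : ℝ) * (W * Real.log 2) ≤ H * b * (W * Real.log 2) := by nlinarith
  exact le_of_mul_le_mul_right h1 (by positivity)

/-- **Soundness of `entropyLeCheck`**: `H(w/W) ≤ a/b`. [folklore] -/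
theorem shannonEntropy_le_of_check {w : ι → ℕ} {W : ℕ} {a : ℤ} {b : ℕ}
    (h : entropyLeCheck w W a b = true) :
    shannonEntropy (fun i => (w i : ℝ) / W) ≤ (a : ℝ) / b := by
  simp only [entropyLeCheck, Bool.and_eq_true, decide_eq_true_eq] at h
  obtain ⟨⟨⟨hW, hW0⟩, hb⟩, hform⟩ := h
  have hV := logFormVal_nonneg hform
  rw [logFormVal_entropyLeForm] at hV
  have hid := log_two_mul_shannonEntropy_natWeights w hW hW0
  have hWR : (0 : ℝ) < W := by exact_mod_cast hW0
  have hbR : (0 : ℝ) < b := by exact_mod_cast hb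
  have hl2 : 0 < Real.log 2 := Real.log_pos one_lt_two
  set H := shannonEntropy (fun i => (w i : ℝ) / W)
  have hid' : (W : ℝ) * Real.log 2 * H = W * Real.log W - ∑ i, (w i : ℝ) * Real.log (w i) := by
    rw [mul_assoc, hid, mul_sub, mul_div_cancel₀ _ hWR.ne']
  rw [le_div_iff₀ hbR]
  have h1 : H * b * (W * Real.log 2) ≤ (a : ℝ) * (W * Real.log 2) := by nlinarith
  exact le_of_mul_le_mul_right h1 (by positivity)

end Entropy

/-! ## Maximum entropy given marginals: the dual certificate -/

section MaxEnt

variable {ι κ μ : Type*} [Fintype ι] [Fintype κ] [Fintype μ]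

/-- The marginal weights `W_X(a) = ∑_{b,c} w(a,b,c)`. [folklore] -/
def margX (w : ι × κ × μ → ℕ) (a : ι) : ℕ := ∑ b, ∑ c, w (a, b, c)

/-- The marginal weights `W_Y(b) = ∑_{a,c} w(a,b,c)`. [folklore] -/
def margY (w : ι × κ × μ → ℕ) (b : κ) : ℕ := ∑ a, ∑ c, w (a, b, c)

/-- The marginal weights `W_Z(c) = ∑_{a,b} w(a,b,c)`. [folklore] -/
def margZ (w : ι × κ × μ → ℕ) (c : μ) : ℕ := ∑ a, ∑ b, w (a, b, c)

/-- The partition sum `S(u) = ∑_{(a,b,c) ∈ Φ} u_X(a) u_Y(b) u_Z(c)` of the dual. [folklore] -/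
def dualPartitionSum (Φ : Finset (ι × κ × μ)) (uX : ι → ℚ) (uY : κ → ℚ) (uZ : μ → ℚ) : ℚ :=
  ∑ x ∈ Φ, uX x.1 * uY x.2.1 * uZ x.2.2

/-- The linear form `a W log 2 − b W log S + b ∑_a W_X(a) log u_X(a) + b ∑_b W_Y(b) log u_Y(b)
+ b ∑_c W_Z(c) log u_Z(c)` whose non-negativity is `g(log u) ≤ a/b` for the dual function `g`.
[folklore] -/
def maxEntLeForm (Φ : Finset (ι × κ × μ)) (w : ι × κ × μ → ℕ) (W : ℕ) (uX : ι → ℚ) (uY : κ → ℚ)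
    (uZ : μ → ℚ) (a : ℤ) (b : ℕ) : Multiset (ℤ × ℕ) :=
  ((a * W, 2) ::ₘ ratLogEntries (-((b : ℤ) * W)) (dualPartitionSum Φ uX uY uZ)) +
    ((Finset.univ.val.map fun i => ratLogEntries ((b : ℤ) * margX w i) (uX i)).sum +
      (Finset.univ.val.map fun j => ratLogEntries ((b : ℤ) * margY w j) (uY j)).sum +
      (Finset.univ.val.map fun l => ratLogEntries ((b : ℤ) * margZ w l) (uZ l)).sum)

/-- `logFormVal` of a multiset sum of forms. [folklore] -/
theorem logFormVal_multiset_sum {τ : Type*} (s : Finset τ) (F : τ → Multiset (ℤ × ℕ)) :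
    logFormVal (s.val.map F).sum = ∑ t ∈ s, logFormVal (F t) := by
  classical
  induction s using Finset.induction_on with
  | empty => simp [logFormVal_zero]
  | insert a s ha ih =>
    rw [Finset.insert_val_of_notMem ha, Multiset.map_cons, Multiset.sum_cons, logFormVal_add, ih,
      Finset.sum_insert ha]

/-- Value of the dual form. [folklore] -/
theorem logFormVal_maxEntLeForm (Φ : Finset (ι × κ × μ)) (w : ι × κ × μ → ℕ) (W : ℕ)
    {uX : ι → ℚ} {uY : κ → ℚ} {uZ : μ → ℚ} (hX : ∀ i, 0 < uX i) (hY : ∀ j, 0 < uY j)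
    (hZ : ∀ l, 0 < uZ l) (hS : 0 < dualPartitionSum Φ uX uY uZ) (a : ℤ) (b : ℕ) :
    logFormVal (maxEntLeForm Φ w W uX uY uZ a b) =
      (a : ℝ) * W * Real.log 2 - b * W * Real.log (dualPartitionSum Φ uX uY uZ : ℚ) +
        ((∑ i, (b : ℝ) * (margX w i : ℝ) * Real.log (uX i : ℚ)) +
          (∑ j, (b : ℝ) * (margY w j : ℝ) * Real.log (uY j : ℚ)) +
          ∑ l, (b : ℝ) * (margZ w l : ℝ) * Real.log (uZ l : ℚ)) := by
  simp only [maxEntLeForm, logFormVal_add, logFormVal_cons, logFormVal_multiset_sum,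
    logFormVal_ratLogEntries _ hS, logFormVal_ratLogEntries _ (hX _), logFormVal_ratLogEntries _ (hY _),
    logFormVal_ratLogEntries _ (hZ _)]
  push_cast
  ring

variable [DecidableEq ι] [DecidableEq κ] [DecidableEq μ]

/-- **Certificate for `max_{α' ∈ D_Φ(w/W)} H(α') ≤ a/b`** (bits) at positive rational multipliers
`u_X, u_Y, u_Z` (the Lagrange multipliers are `λ = log u`). [folklore] -/
def maxEntLeCheck (Φ : Finset (ι × κ × μ)) (w : ι × κ × μ → ℕ) (W : ℕ) (uX : ι → ℚ) (uY : κ → ℚ)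
    (uZ : μ → ℚ) (a : ℤ) (b : ℕ) : Bool :=
  decide (∑ x, w x = W) && decide (0 < W) && decide (0 < b) &&
    decide (∀ x, x ∉ Φ → w x = 0) &&
    decide (∀ i, 0 < uX i) && decide (∀ j, 0 < uY j) && decide (∀ l, 0 < uZ l) &&
    logFormNonneg (maxEntLeForm Φ w W uX uY uZ a b)

/-- **Soundness of `maxEntLeCheck`** (weak duality at `λ = log u`):
`max_{α' ∈ D_Φ(w/W)} H(α') ≤ a/b`. [folklore] -/
theorem maxEntropyGivenMarginals_le_of_check {Φ : Finset (ι × κ × μ)} {w : ι × κ × μ → ℕ} {W : ℕ}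
    {uX : ι → ℚ} {uY : κ → ℚ} {uZ : μ → ℚ} {a : ℤ} {b : ℕ}
    (h : maxEntLeCheck Φ w W uX uY uZ a b = true) :
    maxEntropyGivenMarginals Φ (fun x => (w x : ℝ) / W) ≤ (a : ℝ) / b := by
  simp only [maxEntLeCheck, Bool.and_eq_true, decide_eq_true_eq] at h
  obtain ⟨⟨⟨⟨⟨⟨⟨hW, hW0⟩, hb⟩, hΦ⟩, hX⟩, hY⟩, hZ⟩, hform⟩ := h
  have hWR : (0 : ℝ) < W := by exact_mod_cast hW0
  have hbR : (0 : ℝ) < b := by exact_mod_cast hb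
  have hl2 : 0 < Real.log 2 := Real.log_pos one_lt_two
  set α : ι × κ × μ → ℝ := fun x => (w x : ℝ) / W with hαdef
  -- `α` is a probability distribution supported in `Φ`
  have hα : α ∈ stdSimplex ℝ (ι × κ × μ) := by
    refine ⟨fun x => by positivity, ?_⟩
    simp only [hαdef]
    rw [← Finset.sum_div]
    have : ∑ x, (w x : ℝ) = W := by exact_mod_cast hW
    rw [this, div_self hWR.ne']
  have hαΦ : ∀ x, x ∉ Φ → α x = 0 := fun x hx => by simp [hαdef, hΦ x hx]
  -- `Φ` is non-empty, so the partition sum is positive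
  have hΦne : Φ.Nonempty := by
    by_contra hne
    rw [Finset.not_nonempty_iff_eq_empty] at hne
    have h0 : ∀ x, w x = 0 := fun x => hΦ x (by simp [hne])
    have : ∑ x, w x = 0 := Finset.sum_eq_zero fun x _ => h0 x
    omega
  have hS : 0 < dualPartitionSum Φ uX uY uZ :=
    Finset.sum_pos (fun x _ => mul_pos (mul_pos (hX _) (hY _)) (hZ _)) hΦne
  -- weak duality at `λ = log u`
  have hdual := maxEntropyGivenMarginals_le_entropyDual hα hαΦ (fun i => Real.log (uX i : ℚ))
    (fun j => Real.log (uY j : ℚ)) (fun l => Real.log (uZ l : ℚ))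
  refine hdual.trans ?_
  -- evaluate the dual function
  have hexp : ∀ x : ι × κ × μ, Real.exp (Real.log (uX x.1 : ℚ) + Real.log (uY x.2.1 : ℚ) +
      Real.log (uZ x.2.2 : ℚ)) = ((uX x.1 * uY x.2.1 * uZ x.2.2 : ℚ) : ℝ) := by
    intro x
    have h1 : (0 : ℝ) < (uX x.1 : ℚ) := by exact_mod_cast hX _
    have h2 : (0 : ℝ) < (uY x.2.1 : ℚ) := by exact_mod_cast hY _
    have h3 : (0 : ℝ) < (uZ x.2.2 : ℚ) := by exact_mod_cast hZ _
    rw [Real.exp_add, Real.exp_add, Real.exp_log h1, Real.exp_log h2, Real.exp_log h3]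
    push_cast
    ring
  have hpart : ∑ x ∈ Φ, Real.exp (Real.log (uX x.1 : ℚ) + Real.log (uY x.2.1 : ℚ) +
      Real.log (uZ x.2.2 : ℚ)) = ((dualPartitionSum Φ uX uY uZ : ℚ) : ℝ) := by
    rw [Finset.sum_congr rfl fun x _ => hexp x, dualPartitionSum]
    push_cast
    rfl
  have hmX : ∀ i, marginalDist₁ α i = (margX w i : ℝ) / W := by
    intro i; simp only [marginalDist₁, hαdef, margX]; push_cast
    rw [Finset.sum_div]; refine Finset.sum_congr rfl fun b _ => ?_; rw [Finset.sum_div]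
  have hmY : ∀ j, marginalDist₂ α j = (margY w j : ℝ) / W := by
    intro j; simp only [marginalDist₂, hαdef, margY]; push_cast
    rw [Finset.sum_div]; refine Finset.sum_congr rfl fun b _ => ?_; rw [Finset.sum_div]
  have hmZ : ∀ l, marginalDist₃ α l = (margZ w l : ℝ) / W := by
    intro l; simp only [marginalDist₃, hαdef, margZ]; push_cast
    rw [Finset.sum_div]; refine Finset.sum_congr rfl fun b _ => ?_; rw [Finset.sum_div]
  set LS := Real.log (dualPartitionSum Φ uX uY uZ : ℚ) with hLS
  set TX := ∑ i, (b : ℝ) * (margX w i : ℝ) * Real.log (uX i : ℚ) with hTX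
  set TY := ∑ j, (b : ℝ) * (margY w j : ℝ) * Real.log (uY j : ℚ) with hTY
  set TZ := ∑ l, (b : ℝ) * (margZ w l : ℝ) * Real.log (uZ l : ℚ) with hTZ
  have eX : ∑ i, marginalDist₁ α i * Real.log (uX i : ℚ) = TX / (b * W) := by
    rw [hTX, Finset.sum_div]
    exact Finset.sum_congr rfl fun i _ => by rw [hmX]; field_simp
  have eY : ∑ j, marginalDist₂ α j * Real.log (uY j : ℚ) = TY / (b * W) := by
    rw [hTY, Finset.sum_div]
    exact Finset.sum_congr rfl fun j _ => by rw [hmY]; field_simp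
  have eZ : ∑ l, marginalDist₃ α l * Real.log (uZ l : ℚ) = TZ / (b * W) := by
    rw [hTZ, Finset.sum_div]
    exact Finset.sum_congr rfl fun l _ => by rw [hmZ]; field_simp
  have hdualval : entropyDual Φ (fun i => Real.log (uX i : ℚ)) (fun j => Real.log (uY j : ℚ))
      (fun l => Real.log (uZ l : ℚ)) α = (LS - (TX + TY + TZ) / (b * W)) / Real.log 2 := by
    simp only [entropyDual]
    rw [hpart, eX, eY, eZ]
    ring
  rw [hdualval, div_le_div_iff₀ hl2 hbR]
  -- the certificate: `b W LS − (TX + TY + TZ) ≤ a W log 2`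
  have hV := logFormVal_nonneg hform
  rw [logFormVal_maxEntLeForm Φ w W hX hY hZ hS] at hV
  have h1 : ((LS - (TX + TY + TZ) / (b * W)) * b) * W ≤ (a * Real.log 2) * W := by
    have : (LS - (TX + TY + TZ) / (b * W)) * b * W = b * W * LS - (TX + TY + TZ) := by
      field_simp
    rw [this]
    linarith
  exact le_of_mul_le_mul_right h1 hWR

/-- **The penalty**: `P_α ≤ a/b − H(α)` under the same certificate. [folklore] -/
theorem maxEntropyPenalty_le_of_check {Φ : Finset (ι × κ × μ)} {w : ι × κ × μ → ℕ} {W : ℕ}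
    {uX : ι → ℚ} {uY : κ → ℚ} {uZ : μ → ℚ} {a : ℤ} {b : ℕ}
    (h : maxEntLeCheck Φ w W uX uY uZ a b = true) :
    maxEntropyPenalty Φ (fun x => (w x : ℝ) / W) ≤
      (a : ℝ) / b - shannonEntropy (fun x => (w x : ℝ) / W) :=
  sub_le_sub_right (maxEntropyGivenMarginals_le_of_check h) _

end MaxEnt

/-! ## Adapters: rational data `w/W` as inputs of real-parameter statements -/

section Adapters

variable {ι κ μ : Type*} [Fintype ι] [Fintype κ] [Fintype μ]

/-- `w/W` is a probability vector when `∑ w = W > 0`. [folklore] -/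
theorem natWeights_mem_stdSimplex {w : ι → ℕ} {W : ℕ} (hW : ∑ i, w i = W) (hW0 : 0 < W) :
    (fun i => (w i : ℝ) / W) ∈ stdSimplex ℝ ι := by
  have hWR : (0 : ℝ) < W := by exact_mod_cast hW0
  refine ⟨fun i => by positivity, ?_⟩
  rw [← Finset.sum_div]
  have : ∑ i, (w i : ℝ) = W := by exact_mod_cast hW
  rw [this, div_self hWR.ne']

omit [Fintype ι] in
/-- Support of `w/W` inside `Φ` from the support of `w`. [folklore] -/
theorem natWeights_support {w : ι → ℕ} (W : ℕ) {Φ : Finset ι} (h : ∀ x, x ∉ Φ → w x = 0) :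
    ∀ x, x ∉ Φ → (fun i => (w i : ℝ) / W) x = 0 := fun x hx => by
  simp [h x hx]

omit [Fintype ι] in
/-- The first marginal of `w/W` is `W_X/W`. [folklore] -/
theorem marginalDist₁_natWeights (w : ι × κ × μ → ℕ) (W : ℕ) :
    marginalDist₁ (fun x => (w x : ℝ) / W) = fun a => (margX w a : ℝ) / W := by
  funext a
  simp only [marginalDist₁, margX]
  push_cast
  rw [Finset.sum_div]
  exact Finset.sum_congr rfl fun b _ => by rw [Finset.sum_div]

omit [Fintype κ] in
/-- The second marginal of `w/W` is `W_Y/W`. [folklore] -/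
theorem marginalDist₂_natWeights (w : ι × κ × μ → ℕ) (W : ℕ) :
    marginalDist₂ (fun x => (w x : ℝ) / W) = fun b => (margY w b : ℝ) / W := by
  funext b
  simp only [marginalDist₂, margY]
  push_cast
  rw [Finset.sum_div]
  exact Finset.sum_congr rfl fun a _ => by rw [Finset.sum_div]

omit [Fintype μ] in
/-- The third marginal of `w/W` is `W_Z/W`. [folklore] -/
theorem marginalDist₃_natWeights (w : ι × κ × μ → ℕ) (W : ℕ) :
    marginalDist₃ (fun x => (w x : ℝ) / W) = fun c => (margZ w c : ℝ) / W := by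
  funext c
  simp only [marginalDist₃, margZ]
  push_cast
  rw [Finset.sum_div]
  exact Finset.sum_congr rfl fun a _ => by rw [Finset.sum_div]

/-- `∑_a W_X(a) = ∑ w`. [folklore] -/
theorem sum_margX (w : ι × κ × μ → ℕ) : ∑ a, margX w a = ∑ x, w x := by
  simp only [margX, ← Finset.sum_product', Finset.univ_product_univ]

/-- `∑_b W_Y(b) = ∑ w`. [folklore] -/
theorem sum_margY (w : ι × κ × μ → ℕ) : ∑ b, margY w b = ∑ x, w x := by
  simp only [margY]
  rw [Finset.sum_comm]
  simp only [← Finset.sum_product', Finset.univ_product_univ]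

/-- `∑_c W_Z(c) = ∑ w`. [folklore] -/
theorem sum_margZ (w : ι × κ × μ → ℕ) : ∑ c, margZ w c = ∑ x, w x := by
  simp only [margZ]
  rw [Finset.sum_comm]
  conv_lhs => arg 2; ext a; rw [Finset.sum_comm]
  simp only [← Finset.sum_product', Finset.univ_product_univ]

/-- Entropy of the first marginal of `w/W` = entropy of the weights `W_X`. [folklore] -/
theorem shannonEntropy_marginalDist₁_natWeights (w : ι × κ × μ → ℕ) (W : ℕ) :
    shannonEntropy (marginalDist₁ (fun x => (w x : ℝ) / W)) =
      shannonEntropy (fun a => (margX w a : ℝ) / W) := by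
  rw [marginalDist₁_natWeights]

/-- Entropy of the second marginal of `w/W`. [folklore] -/
theorem shannonEntropy_marginalDist₂_natWeights (w : ι × κ × μ → ℕ) (W : ℕ) :
    shannonEntropy (marginalDist₂ (fun x => (w x : ℝ) / W)) =
      shannonEntropy (fun b => (margY w b : ℝ) / W) := by
  rw [marginalDist₂_natWeights]

/-- Entropy of the third marginal of `w/W`. [folklore] -/
theorem shannonEntropy_marginalDist₃_natWeights (w : ι × κ × μ → ℕ) (W : ℕ) :
    shannonEntropy (marginalDist₃ (fun x => (w x : ℝ) / W)) =
      shannonEntropy (fun c => (margZ w c : ℝ) / W) := by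
  rw [marginalDist₃_natWeights]

end Adapters

/-! ## Maximum entropy given marginals: lower bounds by a witness -/

section MaxEntLower

variable {ι κ μ : Type*} [Fintype ι] [Fintype κ] [Fintype μ] [DecidableEq ι] [DecidableEq κ] [DecidableEq μ]

/-- **Certificate for `max_{α' ∈ D_Φ(w/W)} H(α') ≥ a/b`** by a witness `p/W'` (natural weights `p` of
total `W'`, supported in `Φ`, with the marginals of `w/W`: `W · P_X = W' · W_X` etc.) of certified
entropy `H(p/W') ≥ a/b`. [folklore] -/
def maxEntGeCheck (Φ : Finset (ι × κ × μ)) (w : ι × κ × μ → ℕ) (W : ℕ) (p : ι × κ × μ → ℕ) (W' : ℕ)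
    (a : ℤ) (b : ℕ) : Bool :=
  decide (∑ x, w x = W) && decide (0 < W) && decide (∀ x, x ∉ Φ → p x = 0) &&
    decide (∀ i, W * margX p i = W' * margX w i) && decide (∀ j, W * margY p j = W' * margY w j) &&
    decide (∀ l, W * margZ p l = W' * margZ w l) && entropyGeCheck p W' a b

/-- **Soundness of `maxEntGeCheck`**: `a/b ≤ max_{α' ∈ D_Φ(w/W)} H(α')`. [folklore] -/
theorem maxEntropyGivenMarginals_ge_of_check {Φ : Finset (ι × κ × μ)} {w : ι × κ × μ → ℕ} {W : ℕ}
    {p : ι × κ × μ → ℕ} {W' : ℕ} {a : ℤ} {b : ℕ} (h : maxEntGeCheck Φ w W p W' a b = true) :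
    (a : ℝ) / b ≤ maxEntropyGivenMarginals Φ (fun x => (w x : ℝ) / W) := by
  simp only [maxEntGeCheck, Bool.and_eq_true, decide_eq_true_eq] at h
  obtain ⟨⟨⟨⟨⟨⟨hW, hW0⟩, hΦ⟩, hX⟩, hY⟩, hZ⟩, hent⟩ := h
  have hent' := hent
  simp only [entropyGeCheck, Bool.and_eq_true, decide_eq_true_eq] at hent'
  obtain ⟨⟨⟨hW', hW'0⟩, -⟩, -⟩ := hent'
  have hWR : (0 : ℝ) < W := by exact_mod_cast hW0
  have hW'R : (0 : ℝ) < W' := by exact_mod_cast hW'0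
  refine (shannonEntropy_ge_of_check hent).trans (shannonEntropy_le_maxEntropyGivenMarginals ?_)
  refine ⟨natWeights_mem_stdSimplex hW' hW'0, natWeights_support W' hΦ, ?_, ?_, ?_⟩
  · rw [marginalDist₁_natWeights, marginalDist₁_natWeights]
    funext i
    rw [div_eq_div_iff hW'R.ne' hWR.ne']
    have := hX i
    calc (margX p i : ℝ) * W = ((W * margX p i : ℕ) : ℝ) := by push_cast; ring
      _ = ((W' * margX w i : ℕ) : ℝ) := by rw [this]
      _ = (margX w i : ℝ) * W' := by push_cast; ring
  · rw [marginalDist₂_natWeights, marginalDist₂_natWeights]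
    funext j
    rw [div_eq_div_iff hW'R.ne' hWR.ne']
    have := hY j
    calc (margY p j : ℝ) * W = ((W * margY p j : ℕ) : ℝ) := by push_cast; ring
      _ = ((W' * margY w j : ℕ) : ℝ) := by rw [this]
      _ = (margY w j : ℝ) * W' := by push_cast; ring
  · rw [marginalDist₃_natWeights, marginalDist₃_natWeights]
    funext l
    rw [div_eq_div_iff hW'R.ne' hWR.ne']
    have := hZ l
    calc (margZ p l : ℝ) * W = ((W * margZ p l : ℕ) : ℝ) := by push_cast; ring
      _ = ((W' * margZ w l : ℕ) : ℝ) := by rw [this]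
      _ = (margZ w l : ℝ) * W' := by push_cast; ring

/-- **Two-sided penalty bound**: `P_α ≥ a/b − a'/b'` from a max-entropy witness and an entropy upper
certificate. [folklore] -/
theorem maxEntropyPenalty_ge_of_check {Φ : Finset (ι × κ × μ)} {w : ι × κ × μ → ℕ} {W : ℕ}
    {p : ι × κ × μ → ℕ} {W' : ℕ} {a a' : ℤ} {b b' : ℕ} (h : maxEntGeCheck Φ w W p W' a b = true)
    (h' : entropyLeCheck w W a' b' = true) :
    (a : ℝ) / b - (a' : ℝ) / b' ≤ maxEntropyPenalty Φ (fun x => (w x : ℝ) / W) :=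
  sub_le_sub (maxEntropyGivenMarginals_ge_of_check h) (shannonEntropy_le_of_check h')

end MaxEntLower

/-! ## Tests (kernel evaluation) -/

section Tests

/-- `H(½, ¼, ¼) ≥ 3/2 − 10⁻⁹`. [folklore] -/
example : ((1499999999 : ℤ) : ℝ) / (1000000000 : ℕ) ≤
    shannonEntropy (fun i : Fin 3 => ((![2, 1, 1] i : ℕ) : ℝ) / (4 : ℕ)) :=
  shannonEntropy_ge_of_check (by decide +kernel)

/-- `H(½, ¼, ¼) ≤ 3/2 + 10⁻⁹`. [folklore] -/
example : shannonEntropy (fun i : Fin 3 => ((![2, 1, 1] i : ℕ) : ℝ) / (4 : ℕ)) ≤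
    ((1500000001 : ℤ) : ℝ) / (1000000000 : ℕ) :=
  shannonEntropy_le_of_check (by decide +kernel)

/-- Uniform distribution on `2 × 2 × 2`, `Φ = univ`, `u ≡ 1`: `max_D H ≤ 3 + 10⁻⁹`. [folklore] -/
example : maxEntropyGivenMarginals (Finset.univ : Finset (Fin 2 × Fin 2 × Fin 2))
      (fun x => ((fun _ => (1 : ℕ)) x : ℝ) / (8 : ℕ)) ≤ ((3000000001 : ℤ) : ℝ) / (1000000000 : ℕ) :=
  maxEntropyGivenMarginals_le_of_check (uX := fun _ => 1) (uY := fun _ => 1) (uZ := fun _ => 1)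
    (by decide +kernel)

/-- The Coppersmith–Winograd support `Φ = {i + j + k = 2} ⊆ {0,1,2}³` with weights `3` on the
permutations of `(0,1,1)` and `1` on those of `(0,0,2)` (`W = 12`, `H = 2.3962406251…`, penalty `0`):
`max_D H ≤ 2.396240627` at the multipliers `u = (1, 592313/359256, 868829/958873) ≈ e^{λ*}`. [folklore] -/
example : maxEntropyGivenMarginals
      ((Finset.univ : Finset (Fin 3 × Fin 3 × Fin 3)).filter
        fun x => x.1.val + x.2.1.val + x.2.2.val = 2)
      (fun x => ((fun x : Fin 3 × Fin 3 × Fin 3 =>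
        if x.1.val + x.2.1.val + x.2.2.val = 2 then
          (if x.1.val = 2 ∨ x.2.1.val = 2 ∨ x.2.2.val = 2 then (1 : ℕ) else 3) else 0) x : ℝ) / (12 : ℕ)) ≤
      ((2396240627 : ℤ) : ℝ) / (1000000000 : ℕ) :=
  maxEntropyGivenMarginals_le_of_check
    (uX := ![1, 592313 / 359256, 868829 / 958873])
    (uY := ![1, 592313 / 359256, 868829 / 958873])
    (uZ := ![1, 592313 / 359256, 868829 / 958873]) (by decide +kernel)

/-- … and `max_D H ≥ 2.396240625` by the witness `w` itself. [folklore] -/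
example : ((2396240625 : ℤ) : ℝ) / (1000000000 : ℕ) ≤ maxEntropyGivenMarginals
      ((Finset.univ : Finset (Fin 3 × Fin 3 × Fin 3)).filter
        fun x => x.1.val + x.2.1.val + x.2.2.val = 2)
      (fun x => ((fun x : Fin 3 × Fin 3 × Fin 3 =>
        if x.1.val + x.2.1.val + x.2.2.val = 2 then
          (if x.1.val = 2 ∨ x.2.1.val = 2 ∨ x.2.2.val = 2 then (1 : ℕ) else 3) else 0) x : ℝ) / (12 : ℕ)) :=
  maxEntropyGivenMarginals_ge_of_check (W' := 12)
    (p := fun x : Fin 3 × Fin 3 × Fin 3 =>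
        if x.1.val + x.2.1.val + x.2.2.val = 2 then
          (if x.1.val = 2 ∨ x.2.1.val = 2 ∨ x.2.2.val = 2 then (1 : ℕ) else 3) else 0) (by decide +kernel)

/-- `log₂ 7 ≥ 2.807354922` and `≤ 2.807354923` (`log₂ 7 = 2.8073549220576…`). [folklore] -/
example : ((2807354922 : ℤ) : ℝ) / (1000000000 : ℕ) ≤ Real.logb 2 ((7 : ℕ) / (1 : ℕ) : ℝ) :=
  logb_ge_of_check (by decide +kernel)

example : Real.logb 2 ((7 : ℕ) / (1 : ℕ) : ℝ) ≤ ((2807354923 : ℤ) : ℝ) / (1000000000 : ℕ) :=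
  logb_le_of_check (by decide +kernel)

end Tests

end EntropyCert

end Literature.Computability.AlgebraicComplexity
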